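import Literature.NumberTheory.GaloisCohomology.PoitouTateRestrictedRamificationNaturalAt
import Literature.NumberTheory.GaloisRepresentations.CoinducedDiscreteGaloisModule
import Literature.NumberTheory.GaloisRepresentations.RestrictedCohomologyFunctoriality
import HarnessLib

/-!
# Poitou–Tate duality `Ш²_S × Ш¹_S → ℚ/ℤ` at the LAYERS of a tower: the pairing for the coinduced modules
# `Maps(Γ_K ⧸ V, M)`, `Maps(Γ_K ⧸ V, M')` of an open subgroup `V ≤ Γ_K` and an equivariant pairing `B : M × M' → μₙ`
# (Milne I Thm. 4.10 (a) for the finite extension `K̄^V/K`, via Shapiro), from the base-field named fact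

Topic `NumberTheory/GaloisCohomology`; namespace `Literature.NumberTheory.GaloisCohomology`. THEOREMS ONLY (no
definition, no named fact, no instance, no notation, no `sorry`). Cell `bsd-print-cf2`, width seat `bsd-line-cf2c-w8` g7,
planner ruling (N-PT) 2026-08-29, item (M7): the Poitou–Tate input of ROW 1 of the (α3) kernel descent for
`PrintCf2RubinValueTwo.MainConjClauseAtSplitTwoQuadDA` (stmt-BirchSwinnertonDyer-24721) at the layers `K̃_n` of the
`ℤ₂²`-tower is NOT new print: it is the base-field fact `poitouTate_shaRestricted_tateDual_natural_at K S` (Milne I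
Thm. 4.10 (a) with §4 p. 65; Harari Thm. 17.13 (b)), DISPLAYED as the hypothesis `h`, applied to the COINDUCED module
`Maps(Γ_K ⧸ V, M)` (tree `DiscreteGaloisModule.coind`; its restricted cohomology is `Hⁿ(V/N_S, M)` by Shapiro's lemma
and the `Ш`-conditions correspond by the semi-local Shapiro lemma — the CONSUMER's identifications, not restated here).
The one non-tautological step: for an equivariant `B : M × M' → μₙ` with `m' ↦ B(·, m')` bijective, the summed pairing
`Ψ_V : Maps(Γ_K ⧸ V, M') ⥲ Maps(Γ_K ⧸ V, M)^D`, `Ψ_V(ψ)(φ) = Σ_y B(φ y, ψ y)` (tree `coindTateDualMor`, bijective by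
`coindTateDualHom_bijective`) is an ISOMORPHISM of discrete `Γ_K`-modules, along which `Ш¹_S` is transported
(tree `map_mem_shaRestricted`, `invariantsHom_map_comp_apply`).  Instances: `M' = M^D`, `B = ev` (Milne's
`Ш²_S(L, M) × Ш¹_S(L, M^D)`); `M = Hom(A[p^k], μ_{p^k})`, `M' = A[p^k]`, `B = ev.flip` (descent currency); twists.

* §1 `exists_shaRestrictedHom`, `exists_shaRestricted_addEquiv_of_iso` (`Шⁿ_S` along a morphism / an isomorphism);
* §2 `isUnramifiedOutside_coind` (`N_S ≤ V`), `mem_of_natCard_pi_mem`, `exists_iso_coind_tateDual` (`Ψ_V` an iso),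
  `exists_shaRestricted_addEquiv_coindTateDualMor` (`Ψ_{V,*}` on `Шⁱ_S` an `AddEquiv`),
  `exists_transpose_coindTateDualMor` (the transpose `Ψ₁ ∘ G ∘ Ψ₂⁻¹` and its effect on `Hⁱ(G_S, ·)`);
* §3 **`exists_shaRestricted_pairing_coind_of_natural_at`**: from `h`, bi-additive pairings
  `P n M M' ρ ρ' B hB V hV : Ш²_S(K, Maps(Γ_K ⧸ V, M)) × Ш¹_S(K, Maps(Γ_K ⧸ V, M')) → ℚ/ℤ` (`= B_fact(x, Ψ_{V,*} z)`) with
  (P_V) finiteness and bijectivity of both adjoints under the printed hypotheses, and (N_V) naturality along every pair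
  `F : Maps(Γ_K ⧸ V₁, M₁) → Maps(Γ_K ⧸ V₂, M₂)`, `G : Maps(Γ_K ⧸ V₂, M₂') → Maps(Γ_K ⧸ V₁, M₁')` ADJOINT for the summed
  pairings in `K̄ˣ` — change of level, change of layer (trace = corestriction against pull-back = restriction) and the
  `Γ_K ⧸ V`-action (`r_g` against `r_{g⁻¹}`) are its instances (sequel).

HONEST FRAMING: bookkeeping over a displayed named fact; no case of Poitou–Tate duality is proved; no summit statement is
proved; BSD is not proved by any of this.  presearch: Milne *ADT* I Thm. 4.10 (a), §4 p. 65, I §0 Prop. 0.19; Harari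
Thm. 17.13 (b), Prop. 16.18; NSW (1.6.4), (8.6.7) [corpus].  beyond-print theorem: no.  The main theorem needs
`maxHeartbeats 800000` (instance search on the `Ш`-subtypes of `Hⁱ(G_S, ·)`; one declaration, two long clauses).
AI formalisation, weaker than expert review; the statements are established only by the kernel check.

## References
* J. S. Milne, *Arithmetic Duality Theorems*, 2nd ed. (2006), I Thm. 4.10 (a) (p. 57), §4 p. 65, I §0 Prop. 0.19,
  Cor. 2.3. [MilneADT2006]
* D. Harari, *Galois Cohomology and Class Field Theory* (2020), Thm. 17.13 (b), Prop. 16.18. [Harari2020]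
* J. Neukirch, A. Schmidt, K. Wingberg, *Cohomology of Number Fields* (2008), (1.6.4), (8.6.7).
  [NeukirchSchmidtWingberg2008]
* J.-P. Serre, *Galois Cohomology* (1997), Ch. I §2.2, §2.5. [SerreGaloisCohomology1997]
-/

noncomputable section

open Function NumberField Field IsDedekindDomain CategoryTheory
open scoped NumberField

namespace Literature.NumberTheory.GaloisCohomology

open Literature.NumberTheory.GaloisRepresentations Literature.NumberTheory.GaloisRepresentations.DiscreteGaloisModule

universe u

/-! ## §1. `Шⁿ_S` along module morphisms and isomorphisms -/

section ShaMap
variable {K : Type u} [Field K] [NumberField K]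
  {M : Type u} [AddCommGroup M] [TopologicalSpace M] [DiscreteTopology M]
  {M' : Type u} [AddCommGroup M'] [TopologicalSpace M'] [DiscreteTopology M']
  (ρ : DiscreteGaloisModule K M) (ρ' : DiscreteGaloisModule K M')

/-- `Hⁿ(G_S, F)` restricted to the `Ш`-subgroups, as an additive map `Шⁿ_S(K, M) →+ Шⁿ_S(K, M')` (packaging of the
tree's `DiscreteGaloisModule.map_mem_shaRestricted`). [cite: Harari2020, §17.3 (p. 294)] -/
theorem exists_shaRestrictedHom (F : ρ.toTopRep ⟶ ρ'.toTopRep) (S : Set (HeightOneSpectrum (𝓞 K))) (n : ℕ) :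
    ∃ f : ↥(shaRestricted ρ S n) →+ ↥(shaRestricted ρ' S n), ∀ x : ↥(shaRestricted ρ S n),
      (f x : restrictedCohomology ρ' S n) =
        (ContinuousCohomology.map (ContinuousMonoidHom.id (GaloisGroupUnramifiedOutside K S))
          (ContinuousRep.invariantsHom (N := ramificationSubgroup K S) F) n).hom (x : restrictedCohomology ρ S n) :=
  ⟨{ toFun := fun x => ⟨_, DiscreteGaloisModule.map_mem_shaRestricted F S n x.2⟩
     map_zero' := by
       apply Subtype.ext
       simp only [ZeroMemClass.coe_zero, map_zero]
     map_add' := fun x y => by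
       apply Subtype.ext
       simp only [AddMemClass.coe_add, map_add] },
    fun _ => rfl⟩

/-- **An isomorphism `I : M ≅ M'` of discrete `Γ_K`-modules induces `Шⁿ_S(K, M) ≃+ Шⁿ_S(K, M')`** (`Hⁿ(G_S, I.hom)`, inverse
`Hⁿ(G_S, I.inv)`, by functoriality). [cite: Harari2020, §17.3 (p. 294)] [cite: SerreGaloisCohomology1997, Ch. I §2.2] -/
theorem exists_shaRestricted_addEquiv_of_iso (I : ρ.toTopRep ≅ ρ'.toTopRep) (S : Set (HeightOneSpectrum (𝓞 K)))
    (n : ℕ) :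
    ∃ e : ↥(shaRestricted ρ S n) ≃+ ↥(shaRestricted ρ' S n),
      (∀ x : ↥(shaRestricted ρ S n), (e x : restrictedCohomology ρ' S n) =
        (ContinuousCohomology.map (ContinuousMonoidHom.id (GaloisGroupUnramifiedOutside K S))
          (ContinuousRep.invariantsHom (N := ramificationSubgroup K S) I.hom) n).hom (x : restrictedCohomology ρ S n)) ∧
      ∀ x' : ↥(shaRestricted ρ' S n), (e.symm x' : restrictedCohomology ρ S n) =
        (ContinuousCohomology.map (ContinuousMonoidHom.id (GaloisGroupUnramifiedOutside K S))
          (ContinuousRep.invariantsHom (N := ramificationSubgroup K S) I.inv) n).hom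
          (x' : restrictedCohomology ρ' S n) := by
  obtain ⟨f, hf⟩ := exists_shaRestrictedHom ρ ρ' I.hom S n
  obtain ⟨g, hg⟩ := exists_shaRestrictedHom ρ' ρ I.inv S n
  have hgf : ∀ x, g (f x) = x := fun x => Subtype.ext <|
    ((hg (f x)).trans (congrArg _ (hf x))).trans <|
      (DiscreteGaloisModule.invariantsHom_map_comp_apply I.hom I.inv S n (x : restrictedCohomology ρ S n)).symm.trans
        (by rw [I.hom_inv_id]; exact DiscreteGaloisModule.invariantsHom_map_id_apply S n _)
  have hfg : ∀ x', f (g x') = x' := fun x' => Subtype.ext <|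
    ((hf (g x')).trans (congrArg _ (hg x'))).trans <|
      (DiscreteGaloisModule.invariantsHom_map_comp_apply I.inv I.hom S n
          (x' : restrictedCohomology ρ' S n)).symm.trans
        (by rw [I.inv_hom_id]; exact DiscreteGaloisModule.invariantsHom_map_id_apply S n _)
  exact ⟨{ toFun := f, invFun := g, left_inv := hgf, right_inv := hfg, map_add' := map_add f }, hf, hg⟩

end ShaMap

/-! ## §2. The coinduced module: ramification, order, and `Maps(Γ_K ⧸ V, M') ≅ Maps(Γ_K ⧸ V, M)^D` -/

section Coind
variable {K : Type u} [Field K] {M M' : Type u} [AddCommGroup M] [TopologicalSpace M] [DiscreteTopology M]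
  [AddCommGroup M'] [TopologicalSpace M'] [DiscreteTopology M']
  (ρ : DiscreteGaloisModule K M) (ρ' : DiscreteGaloisModule K M')
  (U : Subgroup (absoluteGaloisGroup K)) [Fintype (absoluteGaloisGroup K ⧸ U)]

/-- **`Maps(Γ_K ⧸ U, M)` is unramified outside `S`** when `M` is and `N_S ≤ U` (inertia above `v ∉ S` lies in the normal
subgroup `N_S`, which then fixes every coset `gU`); e.g. `U = Γ_L`, `L/K` unramified outside `S`. [cite: NeukirchSchmidtWingberg2008, (1.6.4)] -/
theorem isUnramifiedOutside_coind [NumberField K] {S : Set (HeightOneSpectrum (𝓞 K))}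
    (hU : IsOpen (U : Set (absoluteGaloisGroup K))) (hρ : GaloisRep.IsUnramifiedOutside S ρ)
    (hNU : ramificationSubgroup K S ≤ U) : GaloisRep.IsUnramifiedOutside S (ρ.coind U hU) := by
  intro v hv 𝔓 h𝔓 σ hσ
  have h1 : ρ σ = 1 := hρ v hv 𝔓 h𝔓 σ hσ
  have h2 : σ ∈ ramificationSubgroup K S := inertia_le_ramificationSubgroup hv h𝔓 hσ
  refine LinearMap.ext fun φ => funext fun y => ?_
  induction y using QuotientGroup.induction_on with
  | H g =>
    rw [DiscreteGaloisModule.coind_apply_apply, h1, Module.End.one_apply, Module.End.one_apply,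
      MulAction.Quotient.smul_coe, smul_eq_mul]
    congr 1
    rw [QuotientGroup.eq, mul_inv_rev, inv_inv]
    exact hNU ((ramificationSubgroup_normal K S).conj_mem' σ h2 g)

omit [AddCommGroup M] [TopologicalSpace M] [DiscreteTopology M] in
/-- **`#Maps(ι, M) = #M^{#ι}` has the prime support of `#M`**: places dividing `#Maps(ι, M)` divide `#M`, hence lie in `S`.
[cite: MilneADT2006, Ch. I, Thm. 4.10 (a) (p. 57)] -/
theorem mem_of_natCard_pi_mem [NumberField K] {S : Set (HeightOneSpectrum (𝓞 K))} (ι : Type*) [Finite ι]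
    (hS : ∀ v : HeightOneSpectrum (𝓞 K), ((Nat.card M : ℕ) : 𝓞 K) ∈ v.asIdeal → v ∈ S)
    (v : HeightOneSpectrum (𝓞 K)) (hv : ((Nat.card (ι → M) : ℕ) : 𝓞 K) ∈ v.asIdeal) : v ∈ S := by
  rw [Nat.card_fun, Nat.cast_pow] at hv
  exact hS v (v.isPrime.mem_of_pow_mem _ hv)

variable {n : ℕ} (B : M →+ M' →+ MuCarrier K n)

/-- **`Ψ_U : Maps(Γ_K ⧸ U, M') ≅ Maps(Γ_K ⧸ U, M)^D` is an isomorphism of discrete `Γ_K`-modules** when `m' ↦ B(·, m')` is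
bijective (`coindTateDualMor`, `coindTateDualHom_bijective`, `topRepIsoOfEquiv`): `I.hom = Ψ_U`, `(I.hom ψ)(φ) = Σ_y B(φ y, ψ y)`.
[cite: MilneADT2006, Ch. I §0, Cor. 2.3] [cite: NeukirchSchmidtWingberg2008, I §6] -/
theorem exists_iso_coind_tateDual [Finite M] (hU : IsOpen (U : Set (absoluteGaloisGroup K)))
    (hB : ∀ (σ : absoluteGaloisGroup K) (m : M) (m' : M'), B (ρ σ m) (ρ' σ m') = mu K n σ (B m m'))
    (hbij : Bijective fun m' : M' => B.flip m') :
    ∃ I : (ρ'.coind U hU).toTopRep ≅ ((ρ.coind U hU).tateDual n).toTopRep,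
      I.hom = coindTateDualMor ρ ρ' U B hU hB ∧
        ∀ (ψ : absoluteGaloisGroup K ⧸ U → M') (φ : absoluteGaloisGroup K ⧸ U → M),
          I.hom.hom ψ φ = ∑ y : absoluteGaloisGroup K ⧸ U, B (φ y) (ψ y) := by
  haveI : DiscreteTopology ((ρ'.coind U hU).toTopRep) :=
    inferInstanceAs (DiscreteTopology (absoluteGaloisGroup K ⧸ U → M'))
  haveI : DiscreteTopology (((ρ.coind U hU).tateDual n).toTopRep) :=
    inferInstanceAs (DiscreteTopology (TateDual K (absoluteGaloisGroup K ⧸ U → M) n))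
  let e : (ρ'.coind U hU).toTopRep ≃L[ℤ] ((ρ.coind U hU).tateDual n).toTopRep :=
    { (LinearEquiv.ofBijective (coindTateDualHom U B).toIntLinearMap (coindTateDualHom_bijective U B hbij)) with
      continuous_toFun := continuous_of_discreteTopology
      continuous_invFun := continuous_of_discreteTopology }
  have he : ∀ (g : absoluteGaloisGroup K) (x : (ρ'.coind U hU).toTopRep),
      e (((ρ'.coind U hU).toTopRep).ρ g x) = (((ρ.coind U hU).tateDual n).toTopRep).ρ g (e x) :=
    fun g x => coindTateDualHom_smul ρ ρ' U B hU hB g x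
  exact ⟨topRepIsoOfEquiv e he, rfl, fun _ _ => rfl⟩

/-- **`Ψ_{U,*} : Шⁱ_S(K, Maps(Γ_K ⧸ U, M')) ≃+ Шⁱ_S(K, Maps(Γ_K ⧸ U, M)^D)`** for `B` perfect on the right (`Hⁱ(G_S, ·)` of the
isomorphism `Ψ_U`). [cite: MilneADT2006, Ch. I §0, Cor. 2.3] [cite: Harari2020, §17.3 (p. 294)] -/
theorem exists_shaRestricted_addEquiv_coindTateDualMor [NumberField K] [Finite M]
    (hU : IsOpen (U : Set (absoluteGaloisGroup K)))
    (hB : ∀ (σ : absoluteGaloisGroup K) (m : M) (m' : M'), B (ρ σ m) (ρ' σ m') = mu K n σ (B m m'))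
    (hbij : Bijective fun m' : M' => B.flip m') (S : Set (HeightOneSpectrum (𝓞 K))) (i : ℕ) :
    ∃ e : ↥(shaRestricted (ρ'.coind U hU) S i) ≃+ ↥(shaRestricted ((ρ.coind U hU).tateDual n) S i),
      ∀ z : ↥(shaRestricted (ρ'.coind U hU) S i), (e z : restrictedCohomology ((ρ.coind U hU).tateDual n) S i) =
        (ContinuousCohomology.map (ContinuousMonoidHom.id (GaloisGroupUnramifiedOutside K S))
          (ContinuousRep.invariantsHom (N := ramificationSubgroup K S) (ρ := ρ'.coind U hU)
            (ρ' := (ρ.coind U hU).tateDual n) (coindTateDualMor ρ ρ' U B hU hB)) i).hom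
          (z : restrictedCohomology (ρ'.coind U hU) S i) := by
  obtain ⟨I, hI, -⟩ := exists_iso_coind_tateDual ρ ρ' U B hU hB hbij
  obtain ⟨e, he, -⟩ := exists_shaRestricted_addEquiv_of_iso (ρ'.coind U hU) ((ρ.coind U hU).tateDual n) I S i
  exact ⟨e, fun z => by rw [he, hI]⟩

/-- **The transpose `Gᵗ = Ψ₁ ∘ G ∘ Ψ₂⁻¹ : Maps(Γ_K ⧸ U₂, M₂)^D → Maps(Γ_K ⧸ U₁, M₁)^D` of a module map
`G : Maps(Γ_K ⧸ U₂, M₂') → Maps(Γ_K ⧸ U₁, M₁')`** (`B₂` perfect on the right): `(Gᵗ χ)(φ) = Σ_{y₁} B₁(φ y₁, (G ψ) y₁)` for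
`χ = Σ_{y₂} B₂(·, ψ y₂)` (every `χ` is of this form), and `Hⁱ(G_S, Gᵗ) ∘ Hⁱ(G_S, Ψ₂) = Hⁱ(G_S, Ψ₁) ∘ Hⁱ(G_S, G)`.
[cite: MilneADT2006, Ch. I §0, §4 p. 65] [cite: SerreGaloisCohomology1997, Ch. I §2.2] -/
theorem exists_transpose_coindTateDualMor [NumberField K] [Finite M]
    {M₂ M₂' : Type u} [AddCommGroup M₂] [TopologicalSpace M₂] [DiscreteTopology M₂] [Finite M₂]
    [AddCommGroup M₂'] [TopologicalSpace M₂'] [DiscreteTopology M₂']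
    (ρ₂ : DiscreteGaloisModule K M₂) (ρ₂' : DiscreteGaloisModule K M₂')
    (U₂ : Subgroup (absoluteGaloisGroup K)) [Fintype (absoluteGaloisGroup K ⧸ U₂)] {n₂ : ℕ}
    (B₂ : M₂ →+ M₂' →+ MuCarrier K n₂) (hU : IsOpen (U : Set (absoluteGaloisGroup K)))
    (hB : ∀ (σ : absoluteGaloisGroup K) (m : M) (m' : M'), B (ρ σ m) (ρ' σ m') = mu K n σ (B m m'))
    (hU₂ : IsOpen (U₂ : Set (absoluteGaloisGroup K)))
    (hB₂ : ∀ (σ : absoluteGaloisGroup K) (m : M₂) (m' : M₂'), B₂ (ρ₂ σ m) (ρ₂' σ m') = mu K n₂ σ (B₂ m m'))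
    (hbij₂ : Bijective fun m' : M₂' => B₂.flip m') (G : (ρ₂'.coind U₂ hU₂).toTopRep ⟶ (ρ'.coind U hU).toTopRep)
    (S : Set (HeightOneSpectrum (𝓞 K))) (i : ℕ) :
    ∃ Gt : ((ρ₂.coind U₂ hU₂).tateDual n₂).toTopRep ⟶ ((ρ.coind U hU).tateDual n).toTopRep,
      (∀ χ : TateDual K (absoluteGaloisGroup K ⧸ U₂ → M₂) n₂, ∃ ψ : absoluteGaloisGroup K ⧸ U₂ → M₂',
        (∀ φ, χ φ = ∑ y : absoluteGaloisGroup K ⧸ U₂, B₂ (φ y) (ψ y)) ∧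
          ∀ φ, Gt.hom χ φ = ∑ y : absoluteGaloisGroup K ⧸ U, B (φ y) (G.hom ψ y)) ∧
      ∀ c : restrictedCohomology (ρ₂'.coind U₂ hU₂) S i,
        (ContinuousCohomology.map (ContinuousMonoidHom.id (GaloisGroupUnramifiedOutside K S))
            (ContinuousRep.invariantsHom (N := ramificationSubgroup K S) Gt) i).hom
          ((ContinuousCohomology.map (ContinuousMonoidHom.id (GaloisGroupUnramifiedOutside K S))
            (ContinuousRep.invariantsHom (N := ramificationSubgroup K S) (ρ := ρ₂'.coind U₂ hU₂)
              (ρ' := (ρ₂.coind U₂ hU₂).tateDual n₂) (coindTateDualMor ρ₂ ρ₂' U₂ B₂ hU₂ hB₂)) i).hom c) =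
        (ContinuousCohomology.map (ContinuousMonoidHom.id (GaloisGroupUnramifiedOutside K S))
            (ContinuousRep.invariantsHom (N := ramificationSubgroup K S) (ρ := ρ'.coind U hU)
              (ρ' := (ρ.coind U hU).tateDual n) (coindTateDualMor ρ ρ' U B hU hB)) i).hom
          ((ContinuousCohomology.map (ContinuousMonoidHom.id (GaloisGroupUnramifiedOutside K S))
            (ContinuousRep.invariantsHom (N := ramificationSubgroup K S) G) i).hom c) := by
  obtain ⟨I₂, hI₂, hI₂'⟩ := exists_iso_coind_tateDual ρ₂ ρ₂' U₂ B₂ hU₂ hB₂ hbij₂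
  have h1 : ∀ ψ, I₂.inv.hom (I₂.hom.hom ψ) = ψ := fun ψ => congrArg (fun T => T.hom ψ) I₂.hom_inv_id
  have h2 : ∀ χ, I₂.hom.hom (I₂.inv.hom χ) = χ := fun χ => congrArg (fun T => T.hom χ) I₂.inv_hom_id
  refine ⟨I₂.inv ≫ G ≫ coindTateDualMor ρ ρ' U B hU hB, fun χ => ⟨I₂.inv.hom χ, fun φ => ?_, fun φ => ?_⟩, fun c => ?_⟩
  · rw [← hI₂' (I₂.inv.hom χ) φ, h2]
  · change (coindTateDualMor ρ ρ' U B hU hB).hom (G.hom (I₂.inv.hom χ)) φ = _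
    rw [DiscreteGaloisModule.coindTateDualMor_hom_apply, DiscreteGaloisModule.coindTateDualHom_apply_apply]
  · -- `Hⁱ(Ψ₂⁻¹) ∘ Hⁱ(Ψ₂) = id`, then functoriality (implicit `TopRep` arguments differ definitionally: `Eq.trans`)
    have i2 : (ContinuousCohomology.map (ContinuousMonoidHom.id (GaloisGroupUnramifiedOutside K S))
          (ContinuousRep.invariantsHom (N := ramificationSubgroup K S) I₂.inv) i).hom
          ((ContinuousCohomology.map (ContinuousMonoidHom.id (GaloisGroupUnramifiedOutside K S))
            (ContinuousRep.invariantsHom (N := ramificationSubgroup K S) I₂.hom) i).hom c) = c :=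
      (DiscreteGaloisModule.invariantsHom_map_comp_apply I₂.hom I₂.inv S i c).symm.trans
        (by rw [I₂.hom_inv_id]; exact DiscreteGaloisModule.invariantsHom_map_id_apply S i c)
    have i1 : (ContinuousCohomology.map (ContinuousMonoidHom.id (GaloisGroupUnramifiedOutside K S))
          (ContinuousRep.invariantsHom (N := ramificationSubgroup K S) (ρ := ρ₂'.coind U₂ hU₂)
            (ρ' := (ρ₂.coind U₂ hU₂).tateDual n₂) (coindTateDualMor ρ₂ ρ₂' U₂ B₂ hU₂ hB₂)) i).hom c =
        (ContinuousCohomology.map (ContinuousMonoidHom.id (GaloisGroupUnramifiedOutside K S))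
          (ContinuousRep.invariantsHom (N := ramificationSubgroup K S) I₂.hom) i).hom c := by
      rw [hI₂]
    rw [i1]
    refine (DiscreteGaloisModule.invariantsHom_map_comp_apply (ρ := (ρ₂.coind U₂ hU₂).tateDual n₂)
      (ρ' := ρ₂'.coind U₂ hU₂) (ρ'' := (ρ.coind U hU).tateDual n) I₂.inv (G ≫ coindTateDualMor ρ ρ' U B hU hB) S i
      _).trans ?_
    refine (congrArg _ i2).trans ?_
    exact DiscreteGaloisModule.invariantsHom_map_comp_apply (ρ := ρ₂'.coind U₂ hU₂) (ρ' := ρ'.coind U hU)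
      (ρ'' := (ρ.coind U hU).tateDual n) G (coindTateDualMor ρ ρ' U B hU hB) S i _

end Coind

/-! ## §3. The Poitou–Tate pairing of the coinduced modules, from the base-field fact -/

section Layers
variable {K : Type} [Field K] [NumberField K]

set_option maxHeartbeats 800000 in
/-- **Poitou–Tate duality at the layers of a tower (Milne I Thm. 4.10 (a) for `K̄^V/K`, through Shapiro), from the base-field
named fact `h` (displayed).**  A family of bi-additive pairings `P : Ш²_S(K, Maps(Γ_K ⧸ V, M)) × Ш¹_S(K, Maps(Γ_K ⧸ V, M')) → ℚ/ℤ`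
(`P(x, z) = B_fact(x, Ψ_{V,*} z)`, `Ψ_V` the summed pairing of the equivariant `B : M × M' → μₙ`) such that (P_V) if
`m' ↦ B(·, m')` is bijective, `n ≥ 1`, `n • M = 0`, `Maps(Γ_K ⧸ V, M)` is unramified outside `S` (`isUnramifiedOutside_coind`)
and every place dividing `#M` lies in `S`, both groups are finite and both adjoints of `P` are bijective; (N_V) for module
maps `F : Maps(Γ_K ⧸ V₁, M₁) → Maps(Γ_K ⧸ V₂, M₂)`, `G : Maps(Γ_K ⧸ V₂, M₂') → Maps(Γ_K ⧸ V₁, M₁')` ADJOINT for the summed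
pairings in `K̄ˣ`, `P₂(F_* x₁, z₂) = P₁(x₁, G_* z₂)` (values-form; maps `ContinuousCohomology.map (id) (invariantsHom ·)`).
[cite: MilneADT2006, Ch. I, Thm. 4.10 (a) (p. 57), §4 p. 65, §0 Cor. 2.3] [cite: Harari2020, Thm. 17.13 (b), Prop. 16.18]
[cite: NeukirchSchmidtWingberg2008, (8.6.7), (1.6.4)] -/
theorem exists_shaRestricted_pairing_coind_of_natural_at (S : Set (HeightOneSpectrum (𝓞 K)))
    (h : poitouTate_shaRestricted_tateDual_natural_at K S) :
    ∃ P : ∀ (n : ℕ) (M M' : Type) [AddCommGroup M] [TopologicalSpace M] [DiscreteTopology M] [Finite M]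
        [AddCommGroup M'] [TopologicalSpace M'] [DiscreteTopology M']
        (ρ : DiscreteGaloisModule K M) (ρ' : DiscreteGaloisModule K M') (B : M →+ M' →+ MuCarrier K n)
        (_ : ∀ (σ : absoluteGaloisGroup K) (m : M) (m' : M'), B (ρ σ m) (ρ' σ m') = mu K n σ (B m m'))
        (V : Subgroup (absoluteGaloisGroup K)) [Fintype (absoluteGaloisGroup K ⧸ V)]
        (hV : IsOpen (V : Set (absoluteGaloisGroup K))),
        ↥(shaRestricted (ρ.coind V hV) S 2) →+ ↥(shaRestricted (ρ'.coind V hV) S 1) →+ AddCircle (1 : ℚ),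
      -- (P_V) finiteness and perfectness at the layer
      (∀ (n : ℕ) [NeZero n] (M M' : Type) [AddCommGroup M] [TopologicalSpace M] [DiscreteTopology M] [Finite M]
          [AddCommGroup M'] [TopologicalSpace M'] [DiscreteTopology M']
          (ρ : DiscreteGaloisModule K M) (ρ' : DiscreteGaloisModule K M') (B : M →+ M' →+ MuCarrier K n)
          (hB : ∀ (σ : absoluteGaloisGroup K) (m : M) (m' : M'), B (ρ σ m) (ρ' σ m') = mu K n σ (B m m'))
          (V : Subgroup (absoluteGaloisGroup K)) [Fintype (absoluteGaloisGroup K ⧸ V)]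
          (hV : IsOpen (V : Set (absoluteGaloisGroup K))),
          (Bijective fun m' : M' => B.flip m') → (∀ m : M, n • m = 0) →
          GaloisRep.IsUnramifiedOutside S (ρ.coind V hV) →
          (∀ v : HeightOneSpectrum (𝓞 K), ((Nat.card M : ℕ) : 𝓞 K) ∈ v.asIdeal → v ∈ S) →
          Finite (shaRestricted (ρ'.coind V hV) S 1) ∧ Finite (shaRestricted (ρ.coind V hV) S 2) ∧
            Bijective (P n M M' ρ ρ' B hB V hV) ∧ Bijective (P n M M' ρ ρ' B hB V hV).flip) ∧
      -- (N_V) naturality along pairs of module maps adjoint for the summed pairings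
      (∀ (n₁ : ℕ) [NeZero n₁] (M₁ M₁' : Type) [AddCommGroup M₁] [TopologicalSpace M₁] [DiscreteTopology M₁]
          [Finite M₁] [AddCommGroup M₁'] [TopologicalSpace M₁'] [DiscreteTopology M₁']
          (ρ₁ : DiscreteGaloisModule K M₁) (ρ₁' : DiscreteGaloisModule K M₁') (B₁ : M₁ →+ M₁' →+ MuCarrier K n₁)
          (hB₁ : ∀ (σ : absoluteGaloisGroup K) (m : M₁) (m' : M₁'), B₁ (ρ₁ σ m) (ρ₁' σ m') = mu K n₁ σ (B₁ m m'))
          (V₁ : Subgroup (absoluteGaloisGroup K)) [Fintype (absoluteGaloisGroup K ⧸ V₁)]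
          (hV₁ : IsOpen (V₁ : Set (absoluteGaloisGroup K)))
          (n₂ : ℕ) [NeZero n₂] (M₂ M₂' : Type) [AddCommGroup M₂] [TopologicalSpace M₂] [DiscreteTopology M₂]
          [Finite M₂] [AddCommGroup M₂'] [TopologicalSpace M₂'] [DiscreteTopology M₂']
          (ρ₂ : DiscreteGaloisModule K M₂) (ρ₂' : DiscreteGaloisModule K M₂') (B₂ : M₂ →+ M₂' →+ MuCarrier K n₂)
          (hB₂ : ∀ (σ : absoluteGaloisGroup K) (m : M₂) (m' : M₂'), B₂ (ρ₂ σ m) (ρ₂' σ m') = mu K n₂ σ (B₂ m m'))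
          (V₂ : Subgroup (absoluteGaloisGroup K)) [Fintype (absoluteGaloisGroup K ⧸ V₂)]
          (hV₂ : IsOpen (V₂ : Set (absoluteGaloisGroup K))),
          (Bijective fun m' : M₂' => B₂.flip m') →
          (∀ m : M₁, n₁ • m = 0) → GaloisRep.IsUnramifiedOutside S (ρ₁.coind V₁ hV₁) →
          (∀ v : HeightOneSpectrum (𝓞 K), ((Nat.card M₁ : ℕ) : 𝓞 K) ∈ v.asIdeal → v ∈ S) →
          (∀ m : M₂, n₂ • m = 0) → GaloisRep.IsUnramifiedOutside S (ρ₂.coind V₂ hV₂) →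
          (∀ v : HeightOneSpectrum (𝓞 K), ((Nat.card M₂ : ℕ) : 𝓞 K) ∈ v.asIdeal → v ∈ S) →
          ∀ (F : (ρ₁.coind V₁ hV₁).toTopRep ⟶ (ρ₂.coind V₂ hV₂).toTopRep)
            (G : (ρ₂'.coind V₂ hV₂).toTopRep ⟶ (ρ₁'.coind V₁ hV₁).toTopRep),
            (∀ (φ : absoluteGaloisGroup K ⧸ V₁ → M₁) (ψ : absoluteGaloisGroup K ⧸ V₂ → M₂'),
              ((Additive.toMul (∑ y : absoluteGaloisGroup K ⧸ V₁, B₁ (φ y) (G.hom ψ y)) :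
                  rootsOfUnity n₁ (AlgebraicClosure K)) : (AlgebraicClosure K)ˣ) =
                ((Additive.toMul (∑ y : absoluteGaloisGroup K ⧸ V₂, B₂ (F.hom φ y) (ψ y)) :
                  rootsOfUnity n₂ (AlgebraicClosure K)) : (AlgebraicClosure K)ˣ)) →
            ∀ (x₁ : ↥(shaRestricted (ρ₁.coind V₁ hV₁) S 2)) (x₂ : ↥(shaRestricted (ρ₂.coind V₂ hV₂) S 2)),
              (x₂ : restrictedCohomology (ρ₂.coind V₂ hV₂) S 2) =
                (ContinuousCohomology.map (ContinuousMonoidHom.id (GaloisGroupUnramifiedOutside K S))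
                  (ContinuousRep.invariantsHom (N := ramificationSubgroup K S) F) 2).hom
                  (x₁ : restrictedCohomology (ρ₁.coind V₁ hV₁) S 2) →
              ∀ (z₂ : ↥(shaRestricted (ρ₂'.coind V₂ hV₂) S 1)) (z₁ : ↥(shaRestricted (ρ₁'.coind V₁ hV₁) S 1)),
                (z₁ : restrictedCohomology (ρ₁'.coind V₁ hV₁) S 1) =
                  (ContinuousCohomology.map (ContinuousMonoidHom.id (GaloisGroupUnramifiedOutside K S))
                    (ContinuousRep.invariantsHom (N := ramificationSubgroup K S) G) 1).hom
                    (z₂ : restrictedCohomology (ρ₂'.coind V₂ hV₂) S 1) →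
                P n₂ M₂ M₂' ρ₂ ρ₂' B₂ hB₂ V₂ hV₂ x₂ z₂ = P n₁ M₁ M₁' ρ₁ ρ₁' B₁ hB₁ V₁ hV₁ x₁ z₁) := by
  obtain ⟨Bf, hP, hN⟩ := h
  -- the transport `Ψ_{V,*}` of `Ш¹_S` along the summed pairing (an `AddMonoidHom`; values `hT` by `rfl`)
  let T : ∀ (n : ℕ) (M M' : Type) [AddCommGroup M] [TopologicalSpace M] [DiscreteTopology M] [Finite M]
      [AddCommGroup M'] [TopologicalSpace M'] [DiscreteTopology M']
      (ρ : DiscreteGaloisModule K M) (ρ' : DiscreteGaloisModule K M') (B : M →+ M' →+ MuCarrier K n)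
      (_ : ∀ (σ : absoluteGaloisGroup K) (m : M) (m' : M'), B (ρ σ m) (ρ' σ m') = mu K n σ (B m m'))
      (V : Subgroup (absoluteGaloisGroup K)) [Fintype (absoluteGaloisGroup K ⧸ V)]
      (hV : IsOpen (V : Set (absoluteGaloisGroup K))),
      ↥(shaRestricted (ρ'.coind V hV) S 1) →+ ↥(shaRestricted ((ρ.coind V hV).tateDual n) S 1) :=
    fun n M M' _ _ _ _ _ _ _ ρ ρ' B hB V _ hV =>
      { toFun := fun z => ⟨_, DiscreteGaloisModule.map_mem_shaRestricted (ρ := ρ'.coind V hV)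
            (ρ' := (ρ.coind V hV).tateDual n) (coindTateDualMor ρ ρ' V B hV hB) S 1 z.2⟩
        map_zero' := by
          apply Subtype.ext
          simp only [ZeroMemClass.coe_zero, map_zero]
        map_add' := fun x y => by
          apply Subtype.ext
          simp only [AddMemClass.coe_add, map_add] }
  have hT : ∀ (n : ℕ) (M M' : Type) [AddCommGroup M] [TopologicalSpace M] [DiscreteTopology M] [Finite M]
      [AddCommGroup M'] [TopologicalSpace M'] [DiscreteTopology M']
      (ρ : DiscreteGaloisModule K M) (ρ' : DiscreteGaloisModule K M') (B : M →+ M' →+ MuCarrier K n)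
      (hB : ∀ (σ : absoluteGaloisGroup K) (m : M) (m' : M'), B (ρ σ m) (ρ' σ m') = mu K n σ (B m m'))
      (V : Subgroup (absoluteGaloisGroup K)) [Fintype (absoluteGaloisGroup K ⧸ V)]
      (hV : IsOpen (V : Set (absoluteGaloisGroup K))) (z : ↥(shaRestricted (ρ'.coind V hV) S 1)),
      (T n M M' ρ ρ' B hB V hV z : restrictedCohomology ((ρ.coind V hV).tateDual n) S 1) =
        (ContinuousCohomology.map (ContinuousMonoidHom.id (GaloisGroupUnramifiedOutside K S))
          (ContinuousRep.invariantsHom (N := ramificationSubgroup K S) (ρ := ρ'.coind V hV)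
            (ρ' := (ρ.coind V hV).tateDual n) (coindTateDualMor ρ ρ' V B hV hB)) 1).hom
          (z : restrictedCohomology (ρ'.coind V hV) S 1) :=
    fun _ _ _ _ _ _ _ _ _ _ _ _ _ _ _ _ _ _ => rfl
  refine ⟨fun n M M' _ _ _ _ _ _ _ ρ ρ' B hB V _ hV =>
      ((Bf n (absoluteGaloisGroup K ⧸ V → M) (ρ.coind V hV)).flip.comp (T n M M' ρ ρ' B hB V hV)).flip, ?_, ?_⟩
  · -- (P_V)
    intro n _ M M' _ _ _ _ _ _ _ ρ ρ' B hB V _ hV hbij hM hur hS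
    obtain ⟨hfin1, hfin2, hb, hbflip⟩ := hP n (absoluteGaloisGroup K ⧸ V → M) (ρ.coind V hV)
      (fun φ => funext fun y => hM (φ y)) hur (mem_of_natCard_pi_mem (absoluteGaloisGroup K ⧸ V) hS)
    -- the transport `T` IS the additive equivalence induced by the isomorphism `Ψ_V`
    obtain ⟨e, he⟩ := exists_shaRestricted_addEquiv_coindTateDualMor.{0} (K := K) ρ ρ' V B hV hB hbij S 1
    have hTe : ∀ z, T n M M' ρ ρ' B hB V hV z = e z := fun z => Subtype.ext (he z).symm
    have hTe' : ⇑(T n M M' ρ ρ' B hB V hV) = ⇑e := funext hTe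
    haveI := hfin1
    refine ⟨Finite.of_injective e e.injective, hfin2, ?_, ?_⟩
    · change Bijective (((Bf n _ (ρ.coind V hV)).flip.comp (T n M M' ρ ρ' B hB V hV)).flip)
      refine ⟨fun x₁ x₂ hx => hb.1 (AddMonoidHom.ext fun z' => ?_), fun χ => ?_⟩
      · obtain ⟨z, rfl⟩ := e.surjective z'
        have hz := DFunLike.congr_fun hx z
        change Bf n _ (ρ.coind V hV) x₁ (T n M M' ρ ρ' B hB V hV z) =
          Bf n _ (ρ.coind V hV) x₂ (T n M M' ρ ρ' B hB V hV z) at hz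
        simpa only [hTe] using hz
      · obtain ⟨x, hx⟩ := hb.2 (χ.comp e.symm.toAddMonoidHom)
        refine ⟨x, AddMonoidHom.ext fun z => ?_⟩
        change Bf n _ (ρ.coind V hV) x (T n M M' ρ ρ' B hB V hV z) = χ z
        rw [hx, hTe, AddMonoidHom.comp_apply]
        exact congrArg χ (e.symm_apply_apply z)
    · have hPf : (((Bf n _ (ρ.coind V hV)).flip.comp (T n M M' ρ ρ' B hB V hV)).flip).flip =
          (Bf n _ (ρ.coind V hV)).flip.comp (T n M M' ρ ρ' B hB V hV) :=
        AddMonoidHom.ext fun _ => AddMonoidHom.ext fun _ => rfl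
      change Bijective ((((Bf n _ (ρ.coind V hV)).flip.comp (T n M M' ρ ρ' B hB V hV)).flip).flip)
      rw [hPf, AddMonoidHom.coe_comp, hTe']
      exact hbflip.comp e.bijective
  · -- (N_V)
    intro n₁ _ M₁ M₁' _ _ _ _ _ _ _ ρ₁ ρ₁' B₁ hB₁ V₁ _ hV₁ n₂ _ M₂ M₂' _ _ _ _ _ _ _ ρ₂ ρ₂' B₂ hB₂ V₂ _ hV₂
      hbij₂ hM₁ hur₁ hS₁ hM₂ hur₂ hS₂ F G hadj x₁ x₂ hx z₂ z₁ hz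
    -- the transpose `Gᵗ = Ψ₁ ∘ G ∘ Ψ₂⁻¹` is adjoint to `F` for the evaluation pairings; apply (N) of the fact
    obtain ⟨Gt, hGt, hGt'⟩ := exists_transpose_coindTateDualMor.{0} (K := K) ρ₁ ρ₁' V₁ B₁ ρ₂ ρ₂' V₂ B₂ hV₁ hB₁
      hV₂ hB₂ hbij₂ G S 1
    refine hN n₁ (absoluteGaloisGroup K ⧸ V₁ → M₁) (ρ₁.coind V₁ hV₁) n₂ (absoluteGaloisGroup K ⧸ V₂ → M₂)
      (ρ₂.coind V₂ hV₂) (fun φ => funext fun y => hM₁ (φ y)) hur₁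
      (mem_of_natCard_pi_mem (absoluteGaloisGroup K ⧸ V₁) hS₁) (fun φ => funext fun y => hM₂ (φ y)) hur₂
      (mem_of_natCard_pi_mem (absoluteGaloisGroup K ⧸ V₂) hS₂) F Gt (fun χ φ => ?_) x₁ x₂ hx
      (T n₂ M₂ M₂' ρ₂ ρ₂' B₂ hB₂ V₂ hV₂ z₂) (T n₁ M₁ M₁' ρ₁ ρ₁' B₁ hB₁ V₁ hV₁ z₁) ?_
    · obtain ⟨ψ, hχ, hGχ⟩ := hGt χ
      rw [hGχ φ, hχ (F.hom φ)]
      exact hadj φ ψ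
    · rw [hT, hT, hz]
      exact (hGt' _).symm
end Layers

end Literature.NumberTheory.GaloisCohomology
end
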